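import Summits.HodgeConjecture.HodgeConjecture.Theses.OG6CharacterSectors

/-!
# Route `OG6CharacterSectors` — assembly item `Assembly` (stmt-HodgeConjecture-9361)

The assembly item records, as a statement, the implication decided by the route's deciding theorem
`Theses.OG6CharacterSectors.closes` (planner-authored, sorry-free, elaborating in the route file):
`ChiralThreefolds → EvenCharacterStrings → InvariantSector → OuterDegrees → OddCharactersOffMiddle →
FourierInversion → SummitBeyondOG6Frames → HodgeConjecture`.  The deciding theorem has literally this type
(pure logic plus `Submodule.sum_mem`: Fourier inversion over the `(ℤ/2)⁸` characters of an
endomorphism-generic OG6 frame, sector by sector), so the item is closed by it.  Nothing here is a case of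
the Hodge conjecture: every sector statement and the NOT-claimed remainder `SummitBeyondOG6Frames` remain
hypotheses.  No definition, no named-fact hypothesis, no sorry.
-/

set_option linter.dupNamespace false

noncomputable section

namespace Summit.HodgeConjecture.HodgeConjecture.Theorems

open Summit.HodgeConjecture.HodgeConjecture.Theses.OG6CharacterSectors in
/-- **Item stmt-HodgeConjecture-9361 (`Assembly`, route `OG6CharacterSectors`)**:
`ChiralThreefolds → EvenCharacterStrings → InvariantSector → OuterDegrees → OddCharactersOffMiddle →
FourierInversion → SummitBeyondOG6Frames → HodgeConjecture`, by the route's sorry-free deciding theorem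
`closes` (for a rational `(p,p)`-class `c` on an endomorphism-generic OG6 frame, `c = Σ_a e_a c` by
Fourier inversion; the `a = 0` term is the invariant sector, the `a ≠ 0` terms are dispatched by parity of
the character and `p ∈ {2, 3, 4}`).  The type is literally the route decl
`Summit.HodgeConjecture.HodgeConjecture.Theses.OG6CharacterSectors.Assembly`.
[cite: Floccari2023, §1] -/
theorem og6CharacterSectors_assembly_proof :
    Summit.HodgeConjecture.HodgeConjecture.Theses.OG6CharacterSectors.Assembly := by
  unfold Summit.HodgeConjecture.HodgeConjecture.Theses.OG6CharacterSectors.Assembly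
  exact closes

end Summit.HodgeConjecture.HodgeConjecture.Theorems

end
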